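/-
Port (cell rh-split, LINE L8 of D-0145): zd-neg g17 `KCertRefutation.lean` sha16 c17c08adb1aee3c4, part A =
its sections 0–4 verbatim (namespace renamed to the tree's, one-line docstrings added where the source had none).
Nothing here bears on the truth of RH.
-/
import Mathlib

/-!
# KCertRefutation, part A — the node `KCertL Lc δ θ`, the IBP operator calculus and the planted-zero witness

Source: cell rh-split, seat zd-neg g17, `HOME/rh-split-zd-neg/g17/KCertRefutation.lean` (c17c08adb1aee3c4,
487 l, Mathlib-only, RH-free, ζ-free); LINE L8 «KCertL FALSE ∀ θ > 0» (item stmt-RiemannHypothesis-21461,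
critic idea-crit-2 PASS-WITH-PRICE, lead RULING #263).  This part: §0 the verbatim copies of x-wuc's `Phi`, `tfT`,
`KCertL` (`KCertScratch.lean` 0bbd026e334cf310 ll.296–331) and `KCertLOn` (`SplitXWucG10l.lean` 5c66b2cf7a8f68bc
ll.3022–3030); §1 integration by parts twice; §2 the polynomial operator `P ↦ P'' + w² P`; §3 real polynomials
as test functions; §4 the witness `h(u) = u (u−1)^{2M} (u+1)^{2M}`, `f = Π_{z=1}^{M} (d² + (z/N)²) h` and the
positivity of its `2 sinh(κ₀ u)` pairing.  Part B (`KCertRefutation.lean`): §5 the transform vanishes on the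
integer net, `tfT f (j/N) 0 = 0` for `|j| ≤ M`, and `pairing_ne_zero`; §6 the band `e^{2π}/4 < 276`; §7
`¬ KCertL Lc δ θ` for all `δ, θ > 0`.

Mechanism: `KCertL` is scale-free in `f` (the ridge term was dropped) and its certificate windows live in the
FIXED band `[−e^{2π}/4, e^{2π}/4]`.  Witness (mesh `N > 1/δ`, `M = 276 N ≥ N e^{2π}/4`):
`f := Π_{z=1}^{M} (d²/du² + (z/N)²) h`, `h(u) = u (u−1)^{2M} (u+1)^{2M}`.  Integrating by parts twice per factor,
`tfT f (j/N) 0 = ∫_{[-1,1]} f(u) e^{i(j/N)u} du = 0` for every integer `|j| ≤ M`, so the certificate condition at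
`(λ, κ) = (j/N, 0)` kills every window of length `> δ` (it contains the mesh point `⌊N b_i⌋/N`), the total credit is
`≤ 0`, and `KCertL` forces the pairing `∫ 2 sinh(κ₀ u) f(u) du` to vanish — but the same integration by parts
evaluates it as `Π_z (κ₀² + (z/N)²) · ∫_{-1}^{1} u (u²−1)^{2M} 2 sinh(κ₀ u) du > 0`.
Nothing here bears on the truth of RH. -/

noncomputable section

set_option linter.dupNamespace false
open Polynomial MeasureTheory Set Complex

namespace Summit.RiemannHypothesis.RiemannHypothesis.Theorems.Splittings.KCertRefutation


/-! ## 0. Verbatim copies (x-wuc KCertScratch 0bbd026e334cf310 ll.296–331) -/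

/-- local copy (G9b l.562) -/
def Phi (κ : ℝ) : ℝ := 4 * (Real.sinh (2 * κ) / (2 * κ) - 1)

/-- `0 ≤ Φ(κ)` for `κ > 0` (from `2κ ≤ sinh 2κ`). -/
theorem Phi_nonneg_of_pos {κ : ℝ} (hκ : 0 < κ) : 0 ≤ Phi κ := by
  unfold Phi
  have h1 : 2 * κ ≤ Real.sinh (2 * κ) := Real.self_le_sinh_iff.2 (by linarith)
  have h2 : 1 ≤ Real.sinh (2 * κ) / (2 * κ) := by
    rw [le_div_iff₀ (by linarith)]; linarith
  linarith

/-- The TEST-FUNCTION TRANSFORM `F_f(λ, κ) = ∫_{[-1,1]} f(u) cosh(κu) e^{iλu} du` (= `⟨f, φ_{λ,κ}⟩`). -/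
def tfT (f : ℝ → ℂ) (lam κ : ℝ) : ℂ :=
  ∫ u in Icc (-1 : ℝ) 1, f u * (Real.cosh (κ * u) : ℂ) * cexp (I * (lam : ℂ) * u)

/-- **K-CERT_{Lc}(δ, θ)** (card §16e): every continuous test function admits a finite INTERVAL CERTIFICATE below
`W_f = inf_κ |F_f(·,κ)|²` on `[−e^{2π}/4, e^{2π}/4]` with windows of length `≤ Lc` whose δ-credit is at least
`2πθ |⟨2 sinh(κ₀ ·), f⟩|² / ((1+ε) Φ(κ₀))`. -/
def KCertL (Lc δ θ : ℝ) : Prop :=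
  ∀ ε : ℝ, 0 < ε → ∀ κ₀ : ℝ, 0 < κ₀ → κ₀ < 1 / 2 → ∀ f : ℝ → ℂ, Continuous f →
    ∃ (m : ℕ) (a b t : Fin m → ℝ),
      (∀ i, -(Real.exp (2 * Real.pi) / 4) ≤ a i ∧ a i < b i ∧ b i ≤ Real.exp (2 * Real.pi) / 4 ∧
          b i - a i ≤ Lc ∧ 0 ≤ t i) ∧
      (∀ lam κ : ℝ, 0 ≤ κ → κ < 1 / 2 →
          (∑ i ∈ Finset.univ.filter (fun i ↦ a i < lam ∧ lam ≤ b i), t i) ≤ ‖tfT f lam κ‖ ^ 2) ∧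
      2 * Real.pi * θ * ‖∫ u in Icc (-1 : ℝ) 1, 2 * (Real.sinh (κ₀ * u) : ℂ) * f u‖ ^ 2 ≤
        (1 + ε) * Phi κ₀ * ∑ i, t i * (b i - a i - δ - (if a i < 0 ∧ 0 ≤ b i then δ else 0))

/-- VERBATIM copy of x-wuc `SplitXWucG10l.lean` 5c66b2cf7a8f68bc ll.3022–3030 (`KCertL` restricted to a class `S`;
x-wuc's (α₁) rung is `KCertLOn SAlpha 400 (3/2) (43/1000)`, their successor items (α₂)/(β) enlarge `S`). -/
def KCertLOn (S : Set (ℝ → ℂ)) (Lc δ θ : ℝ) : Prop :=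
  ∀ ε : ℝ, 0 < ε → ∀ κ₀ : ℝ, 0 < κ₀ → κ₀ < 1 / 2 → ∀ f : ℝ → ℂ, f ∈ S → Continuous f →
    ∃ (m : ℕ) (a b t : Fin m → ℝ),
      (∀ i, -(Real.exp (2 * Real.pi) / 4) ≤ a i ∧ a i < b i ∧ b i ≤ Real.exp (2 * Real.pi) / 4 ∧
          b i - a i ≤ Lc ∧ 0 ≤ t i) ∧
      (∀ lam κ : ℝ, 0 ≤ κ → κ < 1 / 2 →
          (∑ i ∈ Finset.univ.filter (fun i ↦ a i < lam ∧ lam ≤ b i), t i) ≤ ‖tfT f lam κ‖ ^ 2) ∧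
      2 * Real.pi * θ * ‖∫ u in Icc (-1 : ℝ) 1, 2 * (Real.sinh (κ₀ * u) : ℂ) * f u‖ ^ 2 ≤
        (1 + ε) * Phi κ₀ * ∑ i, t i * (b i - a i - δ - (if a i < 0 ∧ 0 ≤ b i then δ else 0))

/-- The unrestricted node `KCertL` is the class node `KCertLOn univ`. -/
theorem kCertLOn_univ_of_kCertL {Lc δ θ : ℝ} (h : KCertL Lc δ θ) : KCertLOn Set.univ Lc δ θ :=
  fun ε hε κ₀ h1 h2 f _ hf ↦ h ε hε κ₀ h1 h2 f hf

/-! ## 1. Integration by parts, twice, with vanishing boundary data -/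

/-- Integration by parts twice on `[-1,1]`: `∫ φ'' ψ = ∫ φ ψ''` when `φ(±1) = φ'(±1) = 0`. -/
theorem ibp2 {φ φ' φ'' ψ ψ' ψ'' : ℝ → ℂ}
    (hφ : ∀ x, HasDerivAt φ (φ' x) x) (hφ' : ∀ x, HasDerivAt φ' (φ'' x) x)
    (hψ : ∀ x, HasDerivAt ψ (ψ' x) x) (hψ' : ∀ x, HasDerivAt ψ' (ψ'' x) x)
    (cφ'' : Continuous φ'') (cψ'' : Continuous ψ'')
    (h1 : φ 1 = 0) (h2 : φ (-1) = 0) (h3 : φ' 1 = 0) (h4 : φ' (-1) = 0) :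
    ∫ x in (-1:ℝ)..1, φ'' x * ψ x = ∫ x in (-1:ℝ)..1, φ x * ψ'' x := by
  have cφ : Continuous φ := continuous_iff_continuousAt.2 fun x ↦ (hφ x).continuousAt
  have cφ' : Continuous φ' := continuous_iff_continuousAt.2 fun x ↦ (hφ' x).continuousAt
  have cψ : Continuous ψ := continuous_iff_continuousAt.2 fun x ↦ (hψ x).continuousAt
  have cψ' : Continuous ψ' := continuous_iff_continuousAt.2 fun x ↦ (hψ' x).continuousAt
  have A := intervalIntegral.integral_mul_deriv_eq_deriv_mul (a := (-1:ℝ)) (b := 1)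
    (u := ψ) (v := φ') (u' := ψ') (v' := φ'')
    (fun x _ ↦ hψ x) (fun x _ ↦ hφ' x) (cψ'.intervalIntegrable _ _) (cφ''.intervalIntegrable _ _)
  have B := intervalIntegral.integral_mul_deriv_eq_deriv_mul (a := (-1:ℝ)) (b := 1)
    (u := ψ') (v := φ) (u' := ψ'') (v' := φ')
    (fun x _ ↦ hψ' x) (fun x _ ↦ hφ x) (cψ''.intervalIntegrable _ _) (cφ'.intervalIntegrable _ _)
  rw [h3, h4] at A
  rw [h1, h2] at B
  simp only [mul_zero, sub_zero, zero_sub] at A B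
  calc ∫ x in (-1:ℝ)..1, φ'' x * ψ x = ∫ x in (-1:ℝ)..1, ψ x * φ'' x := by
        congr 1; ext x; ring
    _ = -∫ x in (-1:ℝ)..1, ψ' x * φ' x := A
    _ = ∫ x in (-1:ℝ)..1, ψ'' x * φ x := by rw [B]; ring
    _ = ∫ x in (-1:ℝ)..1, φ x * ψ'' x := by congr 1; ext x; ring

/-! ## 2. The polynomial operator `P ↦ P'' + w² P` and boundary vanishing -/

/-- `Lz w P = P'' + w² P` on real polynomials. -/
def Lz (w : ℝ) (P : ℝ[X]) : ℝ[X] := derivative (derivative P) + C (w ^ 2) * P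

/-- `opL [w₁, …, w_k] P = (d² + w₁²) ⋯ (d² + w_k²) P`. -/
def opL : List ℝ → ℝ[X] → ℝ[X]
  | [], P => P
  | w :: ws, P => Lz w (opL ws P)

/-- `(X − a)^{k+1} ∣ P ⟹ (X − a)^k ∣ P'`. -/
theorem dvd_derivative_of_pow_succ_dvd {a : ℝ} {k : ℕ} {P : ℝ[X]}
    (h : (X - C a) ^ (k + 1) ∣ P) : (X - C a) ^ k ∣ derivative P := by
  obtain ⟨R, rfl⟩ := h
  rw [derivative_mul, derivative_pow_succ, derivative_X_sub_C, mul_one]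
  refine dvd_add ?_ ?_
  · exact ((dvd_mul_left ((X - C a) ^ k) (C ((k : ℝ) + 1))).mul_right R)
  · exact (pow_dvd_pow _ (Nat.le_succ k)).trans (dvd_mul_right _ _)

/-- `(X − a)^{k+2} ∣ P ⟹ (X − a)^k ∣ Lz w P`. -/
theorem dvd_Lz {a : ℝ} {k : ℕ} {w : ℝ} {P : ℝ[X]} (h : (X - C a) ^ (k + 2) ∣ P) :
    (X - C a) ^ k ∣ Lz w P := by
  unfold Lz
  refine dvd_add ?_ ?_
  · exact dvd_derivative_of_pow_succ_dvd (dvd_derivative_of_pow_succ_dvd h)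
  · exact ((pow_dvd_pow _ (by omega : k ≤ k + 2)).trans h).mul_left _

/-- `(X − a)^{k + 2·|ws|} ∣ P ⟹ (X − a)^k ∣ opL ws P`. -/
theorem dvd_opL {a : ℝ} (ws : List ℝ) :
    ∀ {k : ℕ} {P : ℝ[X]}, (X - C a) ^ (k + 2 * ws.length) ∣ P → (X - C a) ^ k ∣ opL ws P := by
  induction ws with
  | nil => intro k P h; simpa [opL] using h
  | cons w ws ih =>
      intro k P h
      simp only [opL]
      apply dvd_Lz
      apply ih
      have e : k + 2 + 2 * ws.length = k + 2 * (w :: ws).length := by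
        simp only [List.length_cons]; ring
      rw [e]; exact h

/-- A double root at `a`: `P(a) = 0` and `P'(a) = 0`. -/
theorem eval_eq_zero_of_sq_dvd {a : ℝ} {P : ℝ[X]} (h : (X - C a) ^ 2 ∣ P) :
    P.eval a = 0 ∧ (derivative P).eval a = 0 := by
  obtain ⟨R, rfl⟩ := h
  constructor
  · simp [eval_mul]
  · rw [derivative_mul]
    simp [eval_mul, derivative_pow]

/-! ## 3. Real polynomials as complex-valued test functions -/

/-- the continuous function `u ↦ P(u)` viewed in `ℂ` -/
def fC (P : ℝ[X]) : ℝ → ℂ := fun u ↦ ((P.eval u : ℝ) : ℂ)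

/-- `fC P` has derivative `fC P'`. -/
theorem fC_hasDerivAt (P : ℝ[X]) (u : ℝ) : HasDerivAt (fC P) (fC (derivative P) u) u :=
  (P.hasDerivAt u).ofReal_comp

/-- `fC P` is continuous. -/
theorem fC_continuous (P : ℝ[X]) : Continuous (fC P) :=
  continuous_ofReal.comp P.continuous

/-- `fC (Lz w P) = fC P'' + w² · fC P` pointwise. -/
theorem fC_Lz (w : ℝ) (P : ℝ[X]) (x : ℝ) :
    fC (Lz w P) x = fC (derivative (derivative P)) x + ((w : ℂ) ^ 2) * fC P x := by
  simp only [fC, Lz, eval_add, eval_mul, eval_C]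
  push_cast; ring

/-- one factor: `∫ (P'' + w² P) ψ = (c + w²) ∫ P ψ` when `ψ'' = c ψ` and `P` vanishes to order 2 at `±1`. -/
theorem integral_Lz (w : ℝ) (P : ℝ[X]) {ψ ψ' ψ'' : ℝ → ℂ} {c : ℂ}
    (hψ : ∀ x, HasDerivAt ψ (ψ' x) x) (hψ' : ∀ x, HasDerivAt ψ' (ψ'' x) x) (cψ'' : Continuous ψ'')
    (hc : ∀ x, ψ'' x = c * ψ x)
    (h1 : (X - C (1:ℝ)) ^ 2 ∣ P) (h2 : (X - C (-1:ℝ)) ^ 2 ∣ P) :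
    ∫ x in (-1:ℝ)..1, fC (Lz w P) x * ψ x = (c + (w : ℂ) ^ 2) * ∫ x in (-1:ℝ)..1, fC P x * ψ x := by
  have cψ : Continuous ψ := continuous_iff_continuousAt.2 fun x ↦ (hψ x).continuousAt
  have i1 : IntervalIntegrable (fun x ↦ fC (derivative (derivative P)) x * ψ x) volume (-1:ℝ) 1 :=
    ((fC_continuous _).mul cψ).intervalIntegrable _ _
  have i2 : IntervalIntegrable (fun x ↦ ((w : ℂ) ^ 2) * fC P x * ψ x) volume (-1:ℝ) 1 :=
    ((continuous_const.mul (fC_continuous _)).mul cψ).intervalIntegrable _ _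
  have e : ∀ x, fC (Lz w P) x * ψ x =
      fC (derivative (derivative P)) x * ψ x + ((w : ℂ) ^ 2) * fC P x * ψ x := by
    intro x; rw [fC_Lz]; ring
  simp_rw [e]
  rw [intervalIntegral.integral_add i1 i2]
  have hb1 := eval_eq_zero_of_sq_dvd h1
  have hb2 := eval_eq_zero_of_sq_dvd h2
  rw [ibp2 (φ := fC P) (φ' := fC (derivative P)) (φ'' := fC (derivative (derivative P)))
        (fC_hasDerivAt P) (fC_hasDerivAt (derivative P)) hψ hψ' (fC_continuous _) cψ''
        (by simp [fC, hb1.1]) (by simp [fC, hb2.1]) (by simp [fC, hb1.2]) (by simp [fC, hb2.2])]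
  simp_rw [hc]
  have e2 : ∀ x, ((w : ℂ) ^ 2) * fC P x * ψ x = ((w : ℂ) ^ 2) * (fC P x * ψ x) := fun x ↦ by ring
  have e3 : ∀ x, fC P x * (c * ψ x) = c * (fC P x * ψ x) := fun x ↦ by ring
  simp_rw [e2, e3]
  rw [intervalIntegral.integral_const_mul, intervalIntegral.integral_const_mul]
  ring

/-- all factors: `∫ (opL ws P) ψ = Π_{w ∈ ws} (c + w²) · ∫ P ψ`. -/
theorem integral_opL {ψ ψ' ψ'' : ℝ → ℂ} {c : ℂ}
    (hψ : ∀ x, HasDerivAt ψ (ψ' x) x) (hψ' : ∀ x, HasDerivAt ψ' (ψ'' x) x) (cψ'' : Continuous ψ'')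
    (hc : ∀ x, ψ'' x = c * ψ x) (ws : List ℝ) :
    ∀ (P : ℝ[X]), (X - C (1:ℝ)) ^ (2 * ws.length) ∣ P → (X - C (-1:ℝ)) ^ (2 * ws.length) ∣ P →
    ∫ x in (-1:ℝ)..1, fC (opL ws P) x * ψ x =
      (ws.map (fun w : ℝ ↦ c + (w : ℂ) ^ 2)).prod * ∫ x in (-1:ℝ)..1, fC P x * ψ x := by
  induction ws with
  | nil => intro P _ _; simp [opL]
  | cons w ws ih =>
      intro P h1 h2
      simp only [opL, List.map_cons, List.prod_cons]
      have e : 2 + 2 * ws.length = 2 * (w :: ws).length := by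
        simp only [List.length_cons]; ring
      have d1 : (X - C (1:ℝ)) ^ 2 ∣ opL ws P := dvd_opL ws (by rw [e]; exact h1)
      have d2 : (X - C (-1:ℝ)) ^ 2 ∣ opL ws P := dvd_opL ws (by rw [e]; exact h2)
      have hle : 2 * ws.length ≤ 2 * (w :: ws).length := by simp only [List.length_cons]; omega
      rw [integral_Lz w (opL ws P) hψ hψ' cψ'' hc d1 d2,
        ih P ((pow_dvd_pow _ hle).trans h1) ((pow_dvd_pow _ hle).trans h2)]
      ring

/-! ## 4. The witness: `h(u) = u (u−1)^{2M} (u+1)^{2M}`, `f = Π_{z=1}^{M} (d² + (z/N)²) h` -/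

/-- `h = X (X−1)^{2M} (X+1)^{2M}` -/
def hP (M : ℕ) : ℝ[X] := X * ((X - C (1:ℝ)) ^ (2 * M) * (X - C (-1:ℝ)) ^ (2 * M))

/-- the planted zero frequencies `1/N, 2/N, …, M/N` -/
def zs (N M : ℕ) : List ℝ := (List.range' 1 M).map (fun z : ℕ ↦ (z : ℝ) / N)

/-- there are `M` planted frequencies -/
theorem zs_length (N M : ℕ) : (zs N M).length = M := by
  simp only [zs, List.length_map, List.length_range']

/-- the witness test function `f = (d² + (1/N)²) ⋯ (d² + (M/N)²) h` -/
def f (N M : ℕ) : ℝ → ℂ := fC (opL (zs N M) (hP M))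

/-- the witness test function is continuous -/
theorem f_continuous (N M : ℕ) : Continuous (f N M) := fC_continuous _

/-- `(X − 1)^{2M} ∣ h` -/
theorem hP_dvd_one (N M : ℕ) : (X - C (1:ℝ)) ^ (2 * (zs N M).length) ∣ hP M := by
  rw [zs_length]
  exact Dvd.intro (X * (X - C (-1:ℝ)) ^ (2 * M)) (by unfold hP; ring)

/-- `(X + 1)^{2M} ∣ h` -/
theorem hP_dvd_neg_one (N M : ℕ) : (X - C (-1:ℝ)) ^ (2 * (zs N M).length) ∣ hP M := by
  rw [zs_length]
  exact Dvd.intro (X * (X - C (1:ℝ)) ^ (2 * M)) (by unfold hP; ring)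

/-- `h(u) = u (u² − 1)^{2M}` -/
theorem hP_eval (M : ℕ) (u : ℝ) : (hP M).eval u = u * (u ^ 2 - 1) ^ (2 * M) := by
  rw [show (u ^ 2 - 1) ^ (2 * M) = (u - 1) ^ (2 * M) * (u - (-1)) ^ (2 * M) by
    rw [← mul_pow]; ring_nf]
  simp only [hP, eval_mul, eval_pow, eval_sub, eval_X, eval_C]

/-- `fC h (u) = u (u² − 1)^{2M}` (cast to `ℂ`) -/
theorem fC_hP (M : ℕ) (u : ℝ) : fC (hP M) u = ((u * (u ^ 2 - 1) ^ (2 * M) : ℝ) : ℂ) := by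
  simp [fC, hP_eval]

/-- `∫_{-1}^{1} h = 0` (odd integrand; explicit antiderivative). -/
theorem integral_h_zero (M : ℕ) : ∫ u in (-1:ℝ)..1, (u * (u ^ 2 - 1) ^ (2 * M) : ℝ) = 0 := by
  have hF : ∀ u : ℝ, HasDerivAt (fun u : ℝ ↦ (u ^ 2 - 1) ^ (2 * M + 1) / (2 * (2 * M + 1)))
      (u * (u ^ 2 - 1) ^ (2 * M)) u := by
    intro u
    have h1 : HasDerivAt (fun u : ℝ ↦ u ^ 2 - 1) (2 * u) u := by
      simpa using (hasDerivAt_pow 2 u).sub_const 1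
    have h2 : HasDerivAt (fun u : ℝ ↦ (u ^ 2 - 1) ^ (2 * M + 1))
        (((2 * M + 1 : ℕ) : ℝ) * (u ^ 2 - 1) ^ (2 * M + 1 - 1) * (2 * u)) u := h1.pow (2 * M + 1)
    have h3 := h2.div_const (2 * (2 * M + 1) : ℝ)
    refine h3.congr_deriv ?_
    have hM : (0:ℝ) < 2 * (2 * (M : ℝ) + 1) := by positivity
    rw [Nat.add_sub_cancel]; push_cast
    field_simp
  rw [intervalIntegral.integral_eq_sub_of_hasDerivAt (fun u _ ↦ hF u)
    ((by fun_prop : Continuous fun u : ℝ ↦ u * (u ^ 2 - 1) ^ (2 * M)).intervalIntegrable _ _)]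
  norm_num

/-- the integrand of the pairing of `h` with `2 sinh(κ₀ u)` is nonnegative … -/
theorem pair_integrand_nonneg (M : ℕ) {κ₀ : ℝ} (hκ₀ : 0 < κ₀) (u : ℝ) :
    0 ≤ u * (u ^ 2 - 1) ^ (2 * M) * (2 * Real.sinh (κ₀ * u)) := by
  have hp : 0 ≤ (u ^ 2 - 1) ^ (2 * M) := (even_two_mul M).pow_nonneg _
  have hus : 0 ≤ u * Real.sinh (κ₀ * u) := by
    rcases le_total 0 u with hu | hu
    · exact mul_nonneg hu (Real.sinh_nonneg_iff.2 (by positivity))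
    · have : Real.sinh (κ₀ * u) ≤ 0 := Real.sinh_nonpos_iff.2 (by nlinarith)
      nlinarith
  nlinarith

/-- … and positive on `(0, 1)` -/
theorem pair_integrand_pos (M : ℕ) {κ₀ : ℝ} (hκ₀ : 0 < κ₀) {u : ℝ} (hu : u ∈ Ioo (0:ℝ) 1) :
    0 < u * (u ^ 2 - 1) ^ (2 * M) * (2 * Real.sinh (κ₀ * u)) := by
  obtain ⟨hu0, hu1⟩ := hu
  have hne : u ^ 2 - 1 ≠ 0 := by nlinarith
  have hp : 0 < (u ^ 2 - 1) ^ (2 * M) := (even_two_mul M).pow_pos hne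
  have hs : 0 < Real.sinh (κ₀ * u) := Real.sinh_pos_iff.2 (by positivity)
  positivity

/-- `∫_{-1}^{1} h(u) · 2 sinh(κ₀ u) du > 0`. -/
theorem integral_h_sinh_pos (M : ℕ) {κ₀ : ℝ} (hκ₀ : 0 < κ₀) :
    0 < ∫ u in (-1:ℝ)..1, u * (u ^ 2 - 1) ^ (2 * M) * (2 * Real.sinh (κ₀ * u)) := by
  have hc : Continuous fun u : ℝ ↦ u * (u ^ 2 - 1) ^ (2 * M) * (2 * Real.sinh (κ₀ * u)) := by
    fun_prop
  rw [← intervalIntegral.integral_add_adjacent_intervals (b := 0)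
    (hc.intervalIntegrable _ _) (hc.intervalIntegrable _ _)]
  have h1 : 0 ≤ ∫ u in (-1:ℝ)..0, u * (u ^ 2 - 1) ^ (2 * M) * (2 * Real.sinh (κ₀ * u)) :=
    intervalIntegral.integral_nonneg (by norm_num) fun u _ ↦ pair_integrand_nonneg M hκ₀ u
  have h2 : 0 < ∫ u in (0:ℝ)..1, u * (u ^ 2 - 1) ^ (2 * M) * (2 * Real.sinh (κ₀ * u)) :=
    intervalIntegral.intervalIntegral_pos_of_pos_on (hc.intervalIntegrable _ _)
      (fun u hu ↦ pair_integrand_pos M hκ₀ hu) zero_lt_one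
  linarith

end Summit.RiemannHypothesis.RiemannHypothesis.Theorems.Splittings.KCertRefutation
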